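/-
Copyright: b2b-lace packet (tail-bound analyst, gen 2). From the coordinatewise monotonicity
hypothesis ([HS92b] Lemma B.3, printed for `I_{n,0}`; asserted for all `l` in Fitzner's thesis p. 101)
plus `W_d`-invariance to
monotonicity under domination of absolute values (`AbsMonotone`), and the `W_d`-invariance of
`D̂^{(x)}` / `I_{n,l}(x)` themselves (KSUP.md §8 (W3)).
-/
import Literature.Probability.FitznerVanDerHofstad2017.SrwIntegralSupReduction

/-!
# B.3 transport: `I(x) ≥ I(x + e_ι)` (x_ι ≥ 0) + `W_d`-invariance ⇒ `AbsMonotone I`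

1. `DhatSym d (σ x) k = DhatSym d x k` for every signed permutation `σ` (reindex the orbit sum by
   right translation), hence `srwI d n l (σ x) = srwI d n l x`.
2. For any `f : ℤ^d → ℝ` with `f (x + e_ι) ≤ f x` whenever `x_ι ≥ 0` and `f (σ x) = f x`:
   `|z'_μ| ≤ |z_μ| ∀ μ ⇒ f z ≤ f z'`.
So the consumer hypothesis `AbsMonotone (srwI d n (2j))` of `SrwIntegralSupReduction` follows from the
single coordinatewise statement taken as the hypothesis `hB3`.

PRINT STATUS (REFEREE v12 R46/R53.3, DIVERGENCE D39-b): [HS92b] Lemma B.3 is printed for `I_{n,0}` (`m = 0`) only; for `l ≥ 1` the coordinatewise statement is asserted in [FvdH17-NoBLE] Lemma 5.1 / Fitzner's thesis p. 101 with a proof-citation that covers `l = 0` only, so as a hypothesis for general `l` it is a published STATEMENT without a printed proof. The parity-class version needed by the sup rules is a kernel theorem of this tree (`parityMonotone_srwI`, `SrwIntegralParityMonotone`).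
-/

namespace Literature.Probability.FitznerVanDerHofstad2017

open MeasureTheory Finset Real

variable {d : ℕ}

/-! ### 1. `W_d`-invariance of `D̂^{(x)}` and `I_{n,l}` -/

/-- `k·p(σx; ρ) = k·p(x; ρσ)` in the pair parametrisation. [folklore] -/
theorem phase_spAct (x : Fin d → ℤ) (k : Fin d → ℝ) (τ ρ : SgnPermPair d) :
    phase (spAct τ x) k ρ = phase x k (spMul ρ τ) := by
  unfold phase spMul
  refine Finset.sum_congr rfl fun j _ => ?_
  simp only [spAct_apply, Equiv.Perm.mul_apply, Units.val_mul, Int.cast_mul]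
  ring

/-- Right translation `ρ ↦ ρτ` is a bijection of `W_d`. [folklore] -/
theorem spMul_right_bijective (τ : SgnPermPair d) :
    Function.Bijective (fun ρ : SgnPermPair d => spMul ρ τ) := by
  refine Function.bijective_iff_has_inverse.mpr
    ⟨fun σ' => (τ.1⁻¹ * σ'.1, fun j => σ'.2 j * τ.2 ((τ.1⁻¹ * σ'.1) j)), fun ρ => ?_, fun σ' => ?_⟩
  · refine Prod.ext ?_ ?_
    · show τ.1⁻¹ * (τ.1 * ρ.1) = ρ.1
      exact inv_mul_cancel_left τ.1 ρ.1
    · funext j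
      show (ρ.2 j * τ.2 (ρ.1 j)) * τ.2 ((τ.1⁻¹ * (τ.1 * ρ.1)) j) = ρ.2 j
      rw [inv_mul_cancel_left, mul_assoc, Int.units_mul_self, mul_one]
  · refine Prod.ext ?_ ?_
    · show τ.1 * (τ.1⁻¹ * σ'.1) = σ'.1
      exact mul_inv_cancel_left τ.1 σ'.1
    · funext j
      show (σ'.2 j * τ.2 ((τ.1⁻¹ * σ'.1) j)) * τ.2 ((τ.1⁻¹ * σ'.1) j) = σ'.2 j
      rw [mul_assoc, Int.units_mul_self, mul_one]

/-- `D̂^{(σx)}(k) = D̂^{(x)}(k)`: the symmetrised exponential depends only on the `W_d`-orbit.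
[cite: FitznerVanDerHofstad2016NoBLE, (3.34) p. 1071] -/
theorem DhatSym_spAct (τ : SgnPermPair d) (x : Fin d → ℤ) (k : Fin d → ℝ) :
    DhatSym d (spAct τ x) k = DhatSym d x k := by
  rw [DhatSym_eq_sum_pairs, DhatSym_eq_sum_pairs]
  congr 1
  simp_rw [phase_spAct]
  exact (spMul_right_bijective τ).sum_comp (fun σ => Real.cos (phase x k σ))

/-- `I_{n,l}(σx) = I_{n,l}(x)`. [cite: FitznerVanDerHofstad2016NoBLE, (3.35) p. 1071] -/
theorem srwI_spAct (n l : ℕ) (τ : SgnPermPair d) (x : Fin d → ℤ) :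
    srwI d n l (spAct τ x) = srwI d n l x := by
  unfold srwI
  simp_rw [DhatSym_spAct]

/-! ### 2. From the coordinatewise hypothesis (B.3 shape) + invariance to `AbsMonotone` -/

/-- Iterating the unit step: `f (x + m e_ι) ≤ f x` for `x_ι ≥ 0`, `m ∈ ℕ`. [folklore] -/
theorem le_of_B3_steps (f : (Fin d → ℤ) → ℝ)
    (hB3 : ∀ (x : Fin d → ℤ) (ι : Fin d), 0 ≤ x ι → f (x + axisVec ι 1) ≤ f x)
    (x : Fin d → ℤ) (ι : Fin d) (hx : 0 ≤ x ι) (m : ℕ) :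
    f (x + axisVec ι (m : ℤ)) ≤ f x := by
  induction m with
  | zero =>
      have : x + axisVec ι ((0 : ℕ) : ℤ) = x := by
        funext j; simp [axisVec]
      rw [this]
  | succ m ih =>
      have hsplit : x + axisVec ι ((m + 1 : ℕ) : ℤ) = (x + axisVec ι (m : ℤ)) + axisVec ι 1 := by
        funext j; simp only [Pi.add_apply, axisVec]; split_ifs <;> push_cast <;> ring
      have hnn : 0 ≤ (x + axisVec ι (m : ℤ)) ι := by
        simp only [Pi.add_apply, axisVec, if_true]; positivity
      rw [hsplit]
      exact (hB3 _ ι hnn).trans ih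

/-- Monotonicity between non-negative vectors `a ≤ b`: `f b ≤ f a`. [folklore] -/
theorem le_of_B3_nonneg (f : (Fin d → ℤ) → ℝ)
    (hB3 : ∀ (x : Fin d → ℤ) (ι : Fin d), 0 ≤ x ι → f (x + axisVec ι 1) ≤ f x)
    (a b : Fin d → ℤ) (ha : ∀ μ, 0 ≤ a μ) (hab : ∀ μ, a μ ≤ b μ) : f b ≤ f a := by
  -- interpolate coordinate by coordinate: c t = b on coordinates < t, a elsewhere
  let c : ℕ → (Fin d → ℤ) := fun t μ => if (μ : ℕ) < t then b μ else a μ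
  have hc0 : c 0 = a := by funext μ; simp [c]
  have hcd : c d = b := by funext μ; simp [c, μ.isLt]
  have hstep : ∀ t : ℕ, f (c (t + 1)) ≤ f (c t) := by
    intro t
    by_cases ht : t < d
    · -- c (t+1) = c t + (b t - a t) e_t
      set ι : Fin d := ⟨t, ht⟩ with hι
      obtain ⟨m, hm⟩ : ∃ m : ℕ, b ι - a ι = (m : ℤ) := ⟨(b ι - a ι).toNat, by
        rw [Int.toNat_of_nonneg (sub_nonneg.mpr (hab ι))]⟩
      have heq : c (t + 1) = c t + axisVec ι (m : ℤ) := by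
        funext μ
        simp only [c, Pi.add_apply, axisVec]
        by_cases hμ : μ = ι
        · subst hμ
          have h1 : ((⟨t, ht⟩ : Fin d) : ℕ) < t + 1 := Nat.lt_succ_self t
          have h2 : ¬ ((⟨t, ht⟩ : Fin d) : ℕ) < t := lt_irrefl t
          rw [if_pos h1, if_neg h2, if_pos rfl, ← hm]; ring
        · have hne : (μ : ℕ) ≠ t := fun h => hμ (Fin.ext (by rw [h]))
          rw [if_neg hμ, add_zero]
          by_cases hlt : (μ : ℕ) < t
          · rw [if_pos hlt, if_pos (Nat.lt_succ_of_lt hlt)]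
          · have : ¬ (μ : ℕ) < t + 1 := fun h => hne (by omega)
            rw [if_neg hlt, if_neg this]
      have hnn : 0 ≤ c t ι := by
        simp only [c]
        have h2 : ¬ ((⟨t, ht⟩ : Fin d) : ℕ) < t := lt_irrefl t
        rw [if_neg h2]; exact ha ι
      rw [heq]
      exact le_of_B3_steps f hB3 (c t) ι hnn m
    · have : c (t + 1) = c t := by
        funext μ
        have h1 : (μ : ℕ) < t := lt_of_lt_of_le μ.isLt (not_lt.mp ht)
        simp only [c, if_pos h1, if_pos (Nat.lt_succ_of_lt h1)]
      rw [this]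
  have hchain : ∀ t : ℕ, f (c t) ≤ f a := by
    intro t
    induction t with
    | zero => rw [hc0]
    | succ t ih => exact (hstep t).trans ih
  simpa [hcd] using hchain d

/-- The sign vector `δ(z)_i = sign z_i` (with `+1` at `0`) as units. [folklore] -/
def signUnits (z : Fin d → ℤ) : Fin d → ℤˣ := fun i => if 0 ≤ z i then 1 else -1

/-- `p(z; 1, δ(z)) = |z|` coordinatewise. [folklore] -/
theorem spAct_signUnits (z : Fin d → ℤ) :
    spAct ((1 : Equiv.Perm (Fin d)), signUnits z) z = fun i => |z i| := by
  funext i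
  simp only [spAct_apply, signUnits, Equiv.Perm.one_apply]
  split_ifs with h
  · simp [abs_of_nonneg h]
  · simp [abs_of_neg (not_le.mp h)]

/-- **B.3 transport**: coordinatewise monotonicity for `x_ι ≥ 0` (the shape of [HS92b] Lemma B.3,
which is printed for `I_{n,0}` only — here a hypothesis on an arbitrary `f`) plus `W_d`-invariance give
monotonicity under domination of absolute values.
[cite: FitznerVanDerHofstad2016NoBLE, Lemma 5.1 p. 1093] -/
theorem absMonotone_of_B3 (f : (Fin d → ℤ) → ℝ)
    (hB3 : ∀ (x : Fin d → ℤ) (ι : Fin d), 0 ≤ x ι → f (x + axisVec ι 1) ≤ f x)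
    (hinv : ∀ (τ : SgnPermPair d) (x : Fin d → ℤ), f (spAct τ x) = f x) :
    AbsMonotone f := by
  intro z z' hzz'
  rw [← hinv (1, signUnits z) z, ← hinv (1, signUnits z') z', spAct_signUnits, spAct_signUnits]
  exact le_of_B3_nonneg f hB3 (fun i => |z' i|) (fun i => |z i|) (fun μ => abs_nonneg _) hzz'

/-- **B.3 transport for the SRW integrals**: if `I_{n,2j}(x + e_ι) ≤ I_{n,2j}(x)` for all `x` with
`x_ι ≥ 0` (the HYPOTHESIS `hB3`: for `l = 0` this is the printed [HS92b] Lemma B.3; for `l ≥ 1` it is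
asserted in [FvdH17-NoBLE] Lemma 5.1 / Fitzner's thesis p. 101 without a printed proof — REFEREE v12
R46), then `AbsMonotone (srwI d n (2j))`, the hypothesis of rule WSUP-PRINT. [cite: FitznerVanDerHofstad2016NoBLE, Lemma 5.1 p. 1093] -/
theorem absMonotone_srwI_of_B3 (n l : ℕ)
    (hB3 : ∀ (x : Fin d → ℤ) (ι : Fin d), 0 ≤ x ι →
      srwI d n l (x + axisVec ι 1) ≤ srwI d n l x) :
    AbsMonotone (srwI d n l) :=
  absMonotone_of_B3 _ hB3 (fun τ x => srwI_spAct n l τ x)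

end Literature.Probability.FitznerVanDerHofstad2017
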